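import Summits.CriticalPhenomena.PercolationContinuityZ3.Theorems.PercNearOneGluingNoHeavyLowerTailQuantitativeHarrisInfluenceFloor
import HarnessLib

/-!
# Explicit strictness of Harris' inequality: a separately influential coordinate gives `Cov ≥ p₀^{2m+2} · J₁ · J₂`

Support file (`--supports stmt-CriticalPhenomena-4575`), prover seat `prim-rate-mine-2` (lane prim-rate, constants-miner (c), BENCH row
M2-R47; `run/shared/lean/prim/prim-rate/prim-rate-mine-2/PROOFS.md` §P47).  No definitions, no named facts, no sorries; standard axioms.

Product measure `prodBernoulli w` on `Set ι` (`ι` finite), weights `w = 0` off a finite support `E` (`m = |E|`) and `p₀ ≤ w ≤ 1 − p₀` on `E`;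
`f, g` monotone nonnegative.  If a coordinate `e ∈ E` changes `f` by `J₁` at a configuration `η₁ ⊆ E` and `g` by `J₂` at a configuration
`η₂ ⊆ E` (SEPARATE influence witnesses — the criterion of `QuantHarris.cov_pos_iff_exists_influence`), then
  `∫ fg − ∫ f ∫ g ≥ w_e(1 − w_e)·Inf_e(f)·Inf_e(g) ≥ p₀² · (p₀^m J₁) · (p₀^m J₂) = p₀^{2m+2} J₁ J₂`
(the influence-product floor `QuantHarris.influence_mul_influence_le_cov_prodBernoulli` + every atom inside `E` weighs at least `p₀^m`).

* `QuantHarris.pow_card_le_weight` — `p₀^{|E|} ≤ weight(η)` for `η ⊆ E`;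
* `QuantHarris.jump_mul_weight_le_influence` — `(h(η ∪ e) − h(η ∖ e))·weight(η ∖ e) ≤ Inf_e(h) = ∫ (h(ω ∪ e) − h(ω ∖ e)) dμ`;
* `QuantHarris.cov_ge_pow_mul_jumps` — **`p₀^{2|E|+2}·J₁·J₂ ≤ ∫ fg − ∫ f ∫ g`** — Harris' equality case (row M2-R1 / `cov_pos_iff_exists_influence`)
  with an EXPLICIT, size-dependent constant: the «margin lower bound versus box size» shape of the lane's charter for every isolated Harris
  term of the explicit (S5)/(GEN) floors (rows M2-R21/30/41/45), whose weights `w_{T_{<a}}` have support `E_{T_{<a}} ⊆ E`.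
[cite: Harris1960, Lemma 4.1 (p. 16)] [cite: Talagrand1996, Thm. 1.1 (p. 244)]
-/

noncomputable section

namespace Summit.CriticalPhenomena.PercolationContinuityZ3.Theorems

namespace QuantHarris

open MeasureTheory Set Literature.Probability.LatticeModels Literature.Probability.Percolation
open Literature.Probability.Percolation.BHK2006 (weight weight_nonneg integral_prodBernoulli_eq_sum)
open scoped Classical

variable {ι : Type*} [Fintype ι]

/-- **Atoms inside the support weigh at least `p₀^{|E|}`**: if `w = 0` off `E` and `p₀ ≤ w ≤ 1 − p₀` on `E`, then every configuration
`η ⊆ E` has `weight(η) = ∏_{i ∈ η} w_i ∏_{i ∉ η} (1 − w_i) ≥ p₀^{|E|}` (factors off `E` are `1`). [folklore] -/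
theorem pow_card_le_weight (w : ι → unitInterval) (E : Finset ι) (p₀ : ℝ) (hp0 : 0 ≤ p₀)
    (hE0 : ∀ i, i ∉ E → (w i : ℝ) = 0) (hE1 : ∀ i ∈ E, p₀ ≤ (w i : ℝ) ∧ (w i : ℝ) ≤ 1 - p₀)
    (η : Set ι) (hη : η ⊆ ↑E) : p₀ ^ E.card ≤ weight (fun i => (w i : ℝ)) η := by
  unfold weight
  rw [← Finset.prod_mul_prod_compl E]
  have h1 : p₀ ^ E.card ≤ ∏ i ∈ E, (if i ∈ η then (w i : ℝ) else 1 - w i) := by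
    calc p₀ ^ E.card = ∏ _i ∈ E, p₀ := (Finset.prod_const p₀).symm
      _ ≤ ∏ i ∈ E, (if i ∈ η then (w i : ℝ) else 1 - w i) := by
          refine Finset.prod_le_prod (fun _ _ => hp0) fun i hi => ?_
          split_ifs
          · exact (hE1 i hi).1
          · linarith [(hE1 i hi).2]
  have h2 : ∏ i ∈ Eᶜ, (if i ∈ η then (w i : ℝ) else 1 - w i) = 1 := by
    refine Finset.prod_eq_one fun i hi => ?_
    have hiE : i ∉ E := Finset.mem_compl.1 hi
    have hiη : i ∉ η := fun h => hiE (Finset.mem_coe.1 (hη h))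
    rw [if_neg hiη, hE0 i hiE, sub_zero]
  rw [h2, mul_one]
  exact h1

/-- **One atom bounds the influence from below**: for a monotone `h` and any configuration `η`,
`(h(η ∪ {e}) − h(η ∖ {e})) · weight(η ∖ {e}) ≤ ∫ (h(ω ∪ {e}) − h(ω ∖ {e})) dμ` (the integrand is nonnegative and equals the jump at the
atom `η ∖ {e}`). [cite: Harris1960, Lemma 4.1 (p. 16)] -/
theorem jump_mul_weight_le_influence (w : ι → unitInterval) (h : Set ι → ℝ) (hh : Monotone h) (e : ι) (η : Set ι) :
    (h (insert e η) - h (η \ {e})) * weight (fun i => (w i : ℝ)) (η \ {e}) ≤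
      ∫ ω, (h (insert e ω) - h (ω \ {e})) ∂(prodBernoulli w) := by
  rw [integral_prodBernoulli_eq_sum]
  have hw0 : ∀ i, 0 ≤ ((w i : unitInterval) : ℝ) := fun i => (w i).2.1
  have hw1 : ∀ i, ((w i : unitInterval) : ℝ) ≤ 1 := fun i => (w i).2.2
  have hnn : ∀ ω ∈ (Finset.univ : Finset (Set ι)),
      0 ≤ weight (fun i => (w i : ℝ)) ω * (h (insert e ω) - h (ω \ {e})) := fun ω _ =>
    mul_nonneg (weight_nonneg hw0 hw1 ω) (sub_nonneg.2 (hh (fun x hx => Set.mem_insert_of_mem e hx.1)))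
  have hsingle := Finset.single_le_sum hnn (Finset.mem_univ (η \ {e}))
  have hins : insert e (η \ {e}) = insert e η := Set.insert_sdiff_singleton
  have hdd : (η \ {e}) \ {e} = η \ {e} := by rw [Set.sdiff_sdiff, Set.union_self]
  rw [hins, hdd] at hsingle
  linarith [mul_comm (h (insert e η) - h (η \ {e})) (weight (fun i => (w i : ℝ)) (η \ {e}))]

/-- **Explicit strictness of Harris' inequality.**  Weights `w = 0` off the finite support `E`, `p₀ ≤ w ≤ 1 − p₀` on `E`; `f, g` monotone
nonnegative; a coordinate `e ∈ E` with influence witnesses `η₁, η₂ ⊆ E`.  Then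
`p₀^{2|E|+2} · (f(η₁ ∪ e) − f(η₁ ∖ e)) · (g(η₂ ∪ e) − g(η₂ ∖ e)) ≤ ∫ fg dμ − ∫ f dμ · ∫ g dμ`.
[cite: Harris1960, Lemma 4.1 (p. 16)] [cite: Talagrand1996, Thm. 1.1 (p. 244)] -/
theorem cov_ge_pow_mul_jumps (w : ι → unitInterval) (E : Finset ι) (p₀ : ℝ) (hp0 : 0 ≤ p₀)
    (hE0 : ∀ i, i ∉ E → (w i : ℝ) = 0) (hE1 : ∀ i ∈ E, p₀ ≤ (w i : ℝ) ∧ (w i : ℝ) ≤ 1 - p₀)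
    (f g : Set ι → ℝ) (hf0 : ∀ ω, 0 ≤ f ω) (hg0 : ∀ ω, 0 ≤ g ω) (hf : Monotone f) (hg : Monotone g)
    (e : ι) (he : e ∈ E) (η₁ : Set ι) (hη₁ : η₁ ⊆ ↑E) (η₂ : Set ι) (hη₂ : η₂ ⊆ ↑E) :
    p₀ ^ (2 * E.card + 2) * ((f (insert e η₁) - f (η₁ \ {e})) * (g (insert e η₂) - g (η₂ \ {e}))) ≤
      ∫ ω, f ω * g ω ∂(prodBernoulli w) - (∫ ω, f ω ∂(prodBernoulli w)) * ∫ ω, g ω ∂(prodBernoulli w) := by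
  have hmain := influence_mul_influence_le_cov_prodBernoulli w e f g hf0 hg0 hf hg
  set If : ℝ := ∫ ω, (f (insert e ω) - f (ω \ {e})) ∂(prodBernoulli w) with hIf
  set Ig : ℝ := ∫ ω, (g (insert e ω) - g (ω \ {e})) ∂(prodBernoulli w) with hIg
  set J₁ : ℝ := f (insert e η₁) - f (η₁ \ {e}) with hJ₁
  set J₂ : ℝ := g (insert e η₂) - g (η₂ \ {e}) with hJ₂
  have hJ₁0 : 0 ≤ J₁ := sub_nonneg.2 (hf (fun x hx => Set.mem_insert_of_mem e hx.1))
  have hJ₂0 : 0 ≤ J₂ := sub_nonneg.2 (hg (fun x hx => Set.mem_insert_of_mem e hx.1))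
  have hW1 := pow_card_le_weight w E p₀ hp0 hE0 hE1 (η₁ \ {e}) (fun x hx => hη₁ hx.1)
  have hW2 := pow_card_le_weight w E p₀ hp0 hE0 hE1 (η₂ \ {e}) (fun x hx => hη₂ hx.1)
  have hI1 : J₁ * p₀ ^ E.card ≤ If :=
    (mul_le_mul_of_nonneg_left hW1 hJ₁0).trans (jump_mul_weight_le_influence w f hf e η₁)
  have hI2 : J₂ * p₀ ^ E.card ≤ Ig :=
    (mul_le_mul_of_nonneg_left hW2 hJ₂0).trans (jump_mul_weight_le_influence w g hg e η₂)
  have hpow0 : 0 ≤ p₀ ^ E.card := pow_nonneg hp0 _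
  have hwe : p₀ ^ 2 ≤ (w e : ℝ) * (1 - w e) := by
    have h1 := (hE1 e he).1
    have h2 : p₀ ≤ 1 - (w e : ℝ) := by linarith [(hE1 e he).2]
    nlinarith
  have hwe0 : 0 ≤ (w e : ℝ) * (1 - w e) := mul_nonneg (w e).2.1 (sub_nonneg.2 (w e).2.2)
  have hprod : (J₁ * p₀ ^ E.card) * (J₂ * p₀ ^ E.card) ≤ If * Ig :=
    mul_le_mul hI1 hI2 (mul_nonneg hJ₂0 hpow0) ((mul_nonneg hJ₁0 hpow0).trans hI1)
  calc p₀ ^ (2 * E.card + 2) * (J₁ * J₂)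
      = p₀ ^ 2 * ((J₁ * p₀ ^ E.card) * (J₂ * p₀ ^ E.card)) := by ring
    _ ≤ ((w e : ℝ) * (1 - w e)) * (If * Ig) :=
        mul_le_mul hwe hprod (mul_nonneg (mul_nonneg hJ₁0 hpow0) (mul_nonneg hJ₂0 hpow0)) hwe0
    _ ≤ _ := hmain

end QuantHarris

end Summit.CriticalPhenomena.PercolationContinuityZ3.Theorems

end
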